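import Mathlib

/-! # Auxiliary primes for the pairwise quadratic fields of the icosahedral descent line

The uniform quadratic descent of line Sketch (crux `IcosahedralDescentLevel`, route
ParityBlindBianchi) needs, for every pair of good odd primes `p, p'` and a fixed odd witness prime
`ℓ₁ ∉ {p, p'}`, an auxiliary imaginary quadratic field `K = ℚ(√-D)` in which `2, p, p'` split and
`ℓ₁` is inert, with `D` a prime exceeding a given bound.  Splitting of `2` is guaranteed by
`16 ∣ D + 1`, splitting of an odd prime `q` by `8q ∣ D + 1`, and inertness of `ℓ₁` by `-D` being a
quadratic non-residue modulo `ℓ₁`, rendered elementarily as `∀ x : ℤ, ¬ ℓ₁ ∣ x ^ 2 + D`.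

The supply of such `D` (`exists_auxPrime`) is elementary: the Chinese remainder theorem combines
`D ≡ -1 (mod 16 p p')` with `D ≡ -s (mod ℓ₁)` for a non-square `s` modulo `ℓ₁`; the combined class
is a unit modulo `16 p p' ℓ₁`, so Dirichlet's theorem on primes in arithmetic progressions
(Mathlib's `Nat.infinite_setOf_prime_and_eq_mod`) provides arbitrarily large primes in it.
Everything used is in Mathlib (`ZMod.chineseRemainder`, `FiniteField.exists_nonsquare`).
-/

-- `Summit.Langlands.Langlands.…`: the repeated path component is the tree's layout (D-0017).
set_option linter.dupNamespace false

namespace Summit.Langlands.Langlands.Theorems.IcosahedralDescentLevel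

/-- **Dirichlet + CRT.**  For coprime non-zero moduli `M, N` and unit residues `a : ZMod M`,
`b : ZMod N` there are arbitrarily large primes `D` with `D ≡ a (mod M)` and `D ≡ b (mod N)`.
[folklore] -/
theorem exists_prime_gt_and_cast_eq (M N : ℕ) [NeZero M] [NeZero N] (hMN : M.Coprime N)
    (a : ZMod M) (b : ZMod N) (ha : IsUnit a) (hb : IsUnit b) (B : ℕ) :
    ∃ D : ℕ, D.Prime ∧ B < D ∧ (D : ZMod M) = a ∧ (D : ZMod N) = b := by
  set e := ZMod.chineseRemainder hMN
  have hu : IsUnit (e.symm (a, b)) := (Prod.isUnit_iff.mpr ⟨ha, hb⟩).map e.symm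
  have hinf := Nat.infinite_setOf_prime_and_eq_mod hu
  obtain ⟨D, ⟨hDp, hDmod⟩, hDB⟩ := (hinf.sdiff (Set.finite_Iic B)).nonempty
  have hD : ((D : ZMod M), (D : ZMod N)) = (a, b) := by
    have h := congrArg e hDmod
    rwa [map_natCast, RingEquiv.apply_symm_apply] at h
  exact ⟨D, hDp, not_le.mp hDB, (Prod.ext_iff.mp hD).1, (Prod.ext_iff.mp hD).2⟩

/-- **Field supply** (Dirichlet + CRT): for an odd prime `ℓ₁`, odd primes `p, p'` different from
`ℓ₁` and a bound `B`, there is a prime `D > B` with `16 ∣ D + 1`, `8p ∣ D + 1`, `8p' ∣ D + 1` and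
`-D` a quadratic non-residue modulo `ℓ₁` (so that `2, p, p'` split and `ℓ₁` is inert in `ℚ(√-D)`).
[folklore] -/
theorem exists_auxPrime (ℓ₁ : ℕ) (hℓ₁ : ℓ₁.Prime) (hℓ₁2 : ℓ₁ ≠ 2) (p p' : ℕ) (hp : p.Prime)
    (hp' : p'.Prime) (hp2 : p ≠ 2) (hp'2 : p' ≠ 2) (hpℓ : p ≠ ℓ₁) (hp'ℓ : p' ≠ ℓ₁) (B : ℕ) :
    ∃ D : ℕ, D.Prime ∧ B < D ∧ 16 ∣ D + 1 ∧ 8 * p ∣ D + 1 ∧ 8 * p' ∣ D + 1 ∧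
      ∀ x : ℤ, ¬ ((ℓ₁ : ℤ) ∣ x ^ 2 + D) := by
  -- oddness of `p, p'` is part of the registered interface but not needed for the supply of `D`
  have _ := And.intro hp2 hp'2
  haveI := Fact.mk hℓ₁
  -- a non-square `s` modulo the odd prime `ℓ₁`; it is non-zero
  obtain ⟨s, hs⟩ :=
    FiniteField.exists_nonsquare (F := ZMod ℓ₁) (by rwa [ZMod.ringChar_zmod_n])
  have hs0 : s ≠ 0 := by
    rintro rfl
    exact hs IsSquare.zero
  -- the modulus `16 p p'` is non-zero and coprime to `ℓ₁ ∉ {2, p, p'}`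
  haveI : NeZero (16 * p * p') := ⟨by positivity [hp.pos, hp'.pos]⟩
  have hcop : (16 * p * p').Coprime ℓ₁ := by
    have h2 : Nat.Coprime 2 ℓ₁ := (Nat.coprime_primes Nat.prime_two hℓ₁).2 (Ne.symm hℓ₁2)
    have h16 : Nat.Coprime 16 ℓ₁ := by simpa using h2.pow_left 4
    exact (h16.mul_left ((Nat.coprime_primes hp hℓ₁).2 hpℓ)).mul_left
      ((Nat.coprime_primes hp' hℓ₁).2 hp'ℓ)
  -- Dirichlet in the CRT class `D ≡ -1 (mod 16 p p')`, `D ≡ -s (mod ℓ₁)`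
  obtain ⟨D, hDp, hDB, hDM, hDℓ⟩ := exists_prime_gt_and_cast_eq (16 * p * p') ℓ₁ hcop (-1) (-s)
    isUnit_one.neg (isUnit_iff_ne_zero.mpr (neg_ne_zero.mpr hs0)) B
  have hMD : 16 * p * p' ∣ D + 1 := by
    rw [← ZMod.natCast_eq_zero_iff]
    push_cast
    rw [hDM]
    ring
  refine ⟨D, hDp, hDB, dvd_trans ⟨p * p', by ring⟩ hMD, dvd_trans ⟨2 * p', by ring⟩ hMD,
    dvd_trans ⟨2 * p, by ring⟩ hMD, ?_⟩
  -- `x ^ 2 + D ≡ 0 (mod ℓ₁)` would make `s ≡ -D ≡ x ^ 2` a square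
  intro x hx
  apply hs
  refine ⟨(x : ZMod ℓ₁), ?_⟩
  have h := (ZMod.intCast_zmod_eq_zero_iff_dvd (x ^ 2 + D) ℓ₁).mpr hx
  push_cast at h
  rw [hDℓ] at h
  linear_combination -h

end Summit.Langlands.Langlands.Theorems.IcosahedralDescentLevel
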